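import Summits.KontsevichZagierPeriods.KontsevichZagierPeriods.Theorems.HurwitzMicroSectorsNormalFormPrincipleL2W3ReflectionMove

/-!
# `NormalFormPrinciple` (stmt-KontsevichZagierPeriods-3869), line `SketchIdeator1` —
# leaf `stub_boxRigidity`, layer L2W3 (level-2 weight-3 descent): the reflection relations

Pure proof file (registered sub-goal `l2w3_relations_reflection` of the layer `L2W3`, lead seat
c9; `--supports` the crux). On the decreasing open simplex `Δ = {0 < t₂ < t₁ < t₀ < 1} ⊆ ℝ³` the
*word carriers* are the representations `[Δ, x(t₀) y(t₁) z(t₂)]` for letters among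
`a(u) = 1/u`, `b(u) = 1/(1 − u)`, `c(u) = 1/(1 + u)`, `d(u) = 1/(2 − u)` (the iterated integral
`∫ x y z` over `1 > t₀ > t₁ > t₂ > 0`). The REFLECTION move of the Kontsevich–Zagier calculus
(the landed `l2w3_reflection_move`: ONE change of variables, rule (2), along the affine involution
`t ↦ (1 − t₂, 1 − t₁, 1 − t₀)` of `Δ`, Jacobian `1`) carries the word `x y z` to the reversed word
of reflected letters `z̄ ȳ x̄`, `f̄(u) = f(1 − u)`; on the letters `ā = b`, `b̄ = a`, `c̄ = d`,
`d̄ = c` (`1/(1 − (1 − u)) = 1/u`, `1/(1 + (1 − u)) = 1/(2 − u)`). This file records the five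
resulting CONVERSIONS among word carriers, each being exactly one reflection move (part (1) of
`l2w3_reflection_move`, applied with the target carrier itself as the reflected representation —
its integrand IS the reflected word pointwise, by the displayed identities of rational functions):

* `[ABB] − [AAB]` (MZV duality `ζ(2,1) = ζ(3)`), `[AAD] − [CBB]`, `[DAD] − [CBC]`, `[ADD] − [CCB]`,
  `[DAB] − [ABC]`, all in `KZ.relations`.

The carriers are hypotheses (representations on `Δ` with the displayed integrands).

References: M. Kontsevich, D. Zagier, *Periods* (2001), §1.1–1.2, rule (2). No definitions are
introduced.
-/

noncomputable section

open MeasureTheory Set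
open Literature.NumberTheory.Transcendental Literature.NumberTheory.Transcendental.KZ
open Literature.ModelTheory.ExponentialFields (IsSemialgebraic)

namespace Summit.KontsevichZagierPeriods.HurwitzMicroSectors.NormalFormPrinciple.PiBox.M3

/-- **Stub (`l2w3_relations_reflection`; registered sub-goal of stmt-KontsevichZagierPeriods-3869,
line `SketchIdeator1`, layer `L2W3`).** The reflection relation package on the decreasing open
simplex `Δ = {0 < t₂ < t₁ < t₀ < 1}`: for word carriers given as hypotheses (letters `a = 1/u`,
`b = 1/(1 − u)`, `c = 1/(1 + u)`, `d = 1/(2 − u)` written out), the five conversions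
`[ABB] − [AAB]`, `[AAD] − [CBB]`, `[DAD] − [CBC]`, `[ADD] − [CCB]`, `[DAB] − [ABC]` lie in
`KZ.relations`. Each is ONE reflection move `t ↦ (1 − t₂, 1 − t₁, 1 − t₀)` of `Δ`
(`l2w3_reflection_move`, rule (2), Jacobian `1`) applied to the subtracted carrier `[Δ, x y z]`,
the other carrier being a representation of the reflected word `z(1 − t₀) y(1 − t₁) x(1 − t₂)`:
pointwise `1/(1 − (1 − u)) = 1/u` and `1/(1 + (1 − u)) = 1/(2 − u)`.
[cite: KontsevichZagier2001, §1.2 rule (2)] -/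
theorem l2w3_relations_reflection :
    (∀ (AAB : IntegralRep 3), AAB.domain = {t | 0 < t 2 ∧ t 2 < t 1 ∧ t 1 < t 0 ∧ t 0 < 1} →
        (AAB.integrand = fun t => 1 / t 0 * 1 / t 1 * (1 / (1 - t 2))) →
      ∀ (ABB : IntegralRep 3), ABB.domain = {t | 0 < t 2 ∧ t 2 < t 1 ∧ t 1 < t 0 ∧ t 0 < 1} →
        (ABB.integrand = fun t => 1 / t 0 * (1 / (1 - t 1)) * (1 / (1 - t 2))) →
        of ABB - of AAB ∈ relations) ∧
    (∀ (CBB : IntegralRep 3), CBB.domain = {t | 0 < t 2 ∧ t 2 < t 1 ∧ t 1 < t 0 ∧ t 0 < 1} →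
        (CBB.integrand = fun t => 1 / (1 + t 0) * (1 / (1 - t 1)) * (1 / (1 - t 2))) →
      ∀ (AAD : IntegralRep 3), AAD.domain = {t | 0 < t 2 ∧ t 2 < t 1 ∧ t 1 < t 0 ∧ t 0 < 1} →
        (AAD.integrand = fun t => 1 / t 0 * 1 / t 1 * (1 / (2 - t 2))) →
        of AAD - of CBB ∈ relations) ∧
    (∀ (CBC : IntegralRep 3), CBC.domain = {t | 0 < t 2 ∧ t 2 < t 1 ∧ t 1 < t 0 ∧ t 0 < 1} →
        (CBC.integrand = fun t => 1 / (1 + t 0) * (1 / (1 - t 1)) * (1 / (1 + t 2))) →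
      ∀ (DAD : IntegralRep 3), DAD.domain = {t | 0 < t 2 ∧ t 2 < t 1 ∧ t 1 < t 0 ∧ t 0 < 1} →
        (DAD.integrand = fun t => 1 / (2 - t 0) * 1 / t 1 * (1 / (2 - t 2))) →
        of DAD - of CBC ∈ relations) ∧
    (∀ (CCB : IntegralRep 3), CCB.domain = {t | 0 < t 2 ∧ t 2 < t 1 ∧ t 1 < t 0 ∧ t 0 < 1} →
        (CCB.integrand = fun t => 1 / (1 + t 0) * (1 / (1 + t 1)) * (1 / (1 - t 2))) →
      ∀ (ADD : IntegralRep 3), ADD.domain = {t | 0 < t 2 ∧ t 2 < t 1 ∧ t 1 < t 0 ∧ t 0 < 1} →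
        (ADD.integrand = fun t => 1 / t 0 * (1 / (2 - t 1)) * (1 / (2 - t 2))) →
        of ADD - of CCB ∈ relations) ∧
    (∀ (ABC : IntegralRep 3), ABC.domain = {t | 0 < t 2 ∧ t 2 < t 1 ∧ t 1 < t 0 ∧ t 0 < 1} →
        (ABC.integrand = fun t => 1 / t 0 * (1 / (1 - t 1)) * (1 / (1 + t 2))) →
      ∀ (DAB : IntegralRep 3), DAB.domain = {t | 0 < t 2 ∧ t 2 < t 1 ∧ t 1 < t 0 ∧ t 0 < 1} →
        (DAB.integrand = fun t => 1 / (2 - t 0) * 1 / t 1 * (1 / (1 - t 2))) →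
        of DAB - of ABC ∈ relations) := by
  refine ⟨?_, ?_, ?_, ?_, ?_⟩
  · -- duality on the word `a a b`: the reflected word `b̄ ā ā = a b b` is carried by `ABB`
    intro AAB hAABd hAABi ABB hABBd hABBi
    refine (l2w3_reflection_move (fun u => 1 / u) (fun u => 1 / u) (fun u => 1 / (1 - u)) AAB
      hAABd fun t _ => ?_).1 ABB hABBd fun t _ => ?_
    · simp only [hAABi]
      ring
    · simp only [hABBi]
      ring
  · -- the word `c b b`: the reflected word `b̄ b̄ c̄ = a a d` is carried by `AAD`
    intro CBB hCBBd hCBBi AAD hAADd hAADi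
    refine (l2w3_reflection_move (fun u => 1 / (1 + u)) (fun u => 1 / (1 - u))
      (fun u => 1 / (1 - u)) CBB hCBBd (hCBBi ▸ fun _ _ => rfl)).1 AAD hAADd fun t _ => ?_
    simp only [hAADi]
    ring
  · -- the word `c b c`: the reflected word `c̄ b̄ c̄ = d a d` is carried by `DAD`
    intro CBC hCBCd hCBCi DAD hDADd hDADi
    refine (l2w3_reflection_move (fun u => 1 / (1 + u)) (fun u => 1 / (1 - u))
      (fun u => 1 / (1 + u)) CBC hCBCd (hCBCi ▸ fun _ _ => rfl)).1 DAD hDADd fun t _ => ?_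
    simp only [hDADi]
    ring
  · -- the word `c c b`: the reflected word `b̄ c̄ c̄ = a d d` is carried by `ADD`
    intro CCB hCCBd hCCBi ADD hADDd hADDi
    refine (l2w3_reflection_move (fun u => 1 / (1 + u)) (fun u => 1 / (1 + u))
      (fun u => 1 / (1 - u)) CCB hCCBd (hCCBi ▸ fun _ _ => rfl)).1 ADD hADDd fun t _ => ?_
    simp only [hADDi]
    ring
  · -- the word `a b c`: the reflected word `c̄ b̄ ā = d a b` is carried by `DAB`
    intro ABC hABCd hABCi DAB hDABd hDABi
    refine (l2w3_reflection_move (fun u => 1 / u) (fun u => 1 / (1 - u))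
      (fun u => 1 / (1 + u)) ABC hABCd (hABCi ▸ fun _ _ => rfl)).1 DAB hDABd fun t _ => ?_
    simp only [hDABi]
    ring

end Summit.KontsevichZagierPeriods.HurwitzMicroSectors.NormalFormPrinciple.PiBox.M3
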